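import Summits.ABC.ABC.Theses.DefiniteXi
import Literature.NumberTheory.EllipticCurves.DegreeConjectureAbcMurtyProofs
import Literature.NumberTheory.EllipticCurves.CongruenceNumber
import Literature.NumberTheory.EllipticCurves.PastenSpectralDegreeProofs
import Literature.NumberTheory.EllipticCurves.RationalIsogenyDegrees
import HarnessLib

/-!
# Stub ideation k=3, GEN 3 (family 3: probe the extremes) — helper statements for
`stub_primeToSixDegreeBound` of `Cruxes/SteinbergCore/Lines/p6_tamagawa_split.lean`.

Scratch only (planner seat). Gen 3 keeps the gen-2 content verbatim (Plans B, C♯, D, E below: the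
Plan-B bookkeeping and assembly are SORRY-FREE — `minimalDegUpper_of`, `stub_of_planB`, `cps_le_of_dvd`,
`congruenceNumber_ne_zero`, `stub_of_planC`, `thinSix_of_not_sixSmoothCredit`) and ADDS the converse
direction of the extremal normal form (§ Gen 3): the archimedean LOWER bound `DegLowerArch`
(Zagier + the route binder `PeterssonLowerBound` + Silverman's PROVED covolume inequality) and the
sorry-free implication `sixSmoothCreditPow_of_stub : DegLowerArch → Stub → SixSmoothCreditPow`, so that
`SixSmoothCredit ⟹ Stub ⟹ SixSmoothCreditPow` (the stub IS "abc for Frey triples with the 6-smooth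
part of the minimal degree as credit", up to an `H^θ` loss); and it types the census instrument
`SixLocal` (local six law) with its payoff `freyHeightBound_of_stub_of_sixLocal` (Stub ∧ SixLocal ⟹ abc
for Frey triples, Brandt-free and child-3-free). Sorries remain exactly in: `degUpperArch_of_petersson`
(B1, M), `degLowerArch_of_peterssonLower` (L1, M), `cpsClassInvariant_of_mazurKenku` (C1♯, M),
`freyTriples_finite` (E1, S/M), `stub_of_stubEventually` (E2, M), `freyHeightBound_of_stub_of_sixLocal`
(instrument payoff, M); the residuals `SixSmoothCredit` (B3) / `CongruencePrimeToSix` (C2) / `SixLocal`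
are hypotheses, never sorried. Disproof honoured: every helper keeps the minimality binder and `0 < ε`
(`primeToSixDegreeBound_false_without_minimality`, `_false_without_eps_pos`).
-/
noncomputable section

open IsDedekindDomain WeierstrassCurve NumberField
open Literature.NumberTheory.EllipticCurves Literature.NumberTheory.EllipticCurves.ModularForms
open Literature.NumberTheory
open ModularForms CongruenceSubgroup

namespace Summit.ABC.ABC.Cruxes.SteinbergCore.StubIdeas3

/-- The registered stub, verbatim. -/
def Stub : Prop :=
  ∀ ε : ℝ, 0 < ε → ∃ C : ℝ, ∀ a b : ℤ, IsCoprime a b → a * b * (a + b) ≠ 0 → ∀ (N : ℕ) [NeZero N],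
    (freyCurve a b).conductorNorm ℤ = N →
    ∀ D : ModularParametrizationData (freyCurve a b) N,
      (∀ D' : ModularParametrizationData (freyCurve a b) N, D.deg ≤ D'.deg) →
      ((D.deg / (ordProj[2] D.deg * ordProj[3] D.deg) : ℕ) : ℝ) ≤ C * (N : ℝ) ^ (2 + ε)

/-- Certificate: `Stub` is syntactically the registered stub signature (fully qualified form). -/
example : Stub ↔
    (∀ ε : ℝ, 0 < ε → ∃ C : ℝ, ∀ a b : ℤ, IsCoprime a b → a * b * (a + b) ≠ 0 → ∀ (N : ℕ) [NeZero N],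
      (Literature.NumberTheory.EllipticCurves.freyCurve a b).conductorNorm ℤ = N →
      ∀ D : Literature.NumberTheory.EllipticCurves.ModularForms.ModularParametrizationData
        (Literature.NumberTheory.EllipticCurves.freyCurve a b) N,
        (∀ D' : Literature.NumberTheory.EllipticCurves.ModularForms.ModularParametrizationData
          (Literature.NumberTheory.EllipticCurves.freyCurve a b) N, D.deg ≤ D'.deg) →
        ((D.deg / (ordProj[2] D.deg * ordProj[3] D.deg) : ℕ) : ℝ) ≤ C * (N : ℝ) ^ (2 + ε)) :=
  Iff.rfl

/-! ## Shared binders (tree shapes, verbatim from `abcLe_imp_freyDegreeConjecture_of_petersson_of_manin`) -/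

/-- `hUp`: Petersson upper bound `(f,f) ≤ C₂(η) N^{1+η}` for every `η > 0`. -/
def PeterssonUpper : Prop :=
  ∀ η : ℝ, 0 < η → ∃ C₂ : ℝ, ∀ (N : ℕ) [NeZero N] (W : WeierstrassCurve ℚ) [W.IsElliptic]
    (f : CuspForm (Gamma0 N) 2), IsNewformOf W f →
      (peterssonProduct (Gamma0 N) 2 f f).re ≤ C₂ * (N : ℝ) ^ (1 + η)

/-- `hM`: Frey curves carry data with uniformly bounded Manin constant. -/
def FreyManinBound : Prop :=
  ∃ M : ℕ, ∀ a b : ℤ, IsCoprime a b → a * b * (a + b) ≠ 0 →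
    ∀ (N : ℕ) [NeZero N], (freyCurve a b).conductorNorm ℤ = N →
      ∃ D : ModularParametrizationData (freyCurve a b) N, D.maninConstant.natAbs ≤ M

/-- abc, `≤`-form with exponent `1+ε`. -/
def AbcLe : Prop :=
  ∀ ε : ℝ, 0 < ε → ∃ C : ℝ, ∀ a b c : ℕ, DiophantineGeometry.IsABCTriple a b c →
    (c : ℝ) ≤ C * ((DiophantineGeometry.rad a b c : ℕ) : ℝ) ^ (1 + ε)

/-! ## Plan B — archimedean extremal identity (Zagier–Murty engine run abc-free) -/

/-- **B1 `DegUpperArch θ`** (abc-free, EVERY datum): `deg D ≤ K c_D² N^{1+θ} max(|a|,|b|)`. -/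
def DegUpperArch (θ : ℝ) : Prop :=
  ∃ K : ℝ, ∀ a b : ℤ, IsCoprime a b → a * b * (a + b) ≠ 0 → ∀ (N : ℕ) [NeZero N],
    (freyCurve a b).conductorNorm ℤ = N → ∀ D : ModularParametrizationData (freyCurve a b) N,
      (D.modularDegree : ℝ) ≤
        K * (D.maninConstant : ℝ) ^ 2 * (N : ℝ) ^ (1 + θ) * max (|(a : ℝ)|) (|(b : ℝ)|)

/-- B1 from `hUp` at exponent `θ` (one prover cycle, M: the proof of
`freyDegreeBound_rpow_of_abcLe_of_petersson_of_manin` with the abc step and `hM` deleted). -/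
theorem degUpperArch_of_petersson {θ : ℝ}
    (hUp : ∃ C₂ : ℝ, ∀ (N : ℕ) [NeZero N] (W : WeierstrassCurve ℚ) [W.IsElliptic]
      (f : CuspForm (Gamma0 N) 2), IsNewformOf W f →
        (peterssonProduct (Gamma0 N) 2 f f).re ≤ C₂ * (N : ℝ) ^ (1 + θ)) :
    DegUpperArch θ := by
  sorry

/-- **B2 `MinimalDegUpper θ`**: a MINIMAL datum inherits the bounded-Manin datum's bound. -/
def MinimalDegUpper (θ : ℝ) : Prop :=
  ∃ K : ℝ, ∀ a b : ℤ, IsCoprime a b → a * b * (a + b) ≠ 0 → ∀ (N : ℕ) [NeZero N],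
    (freyCurve a b).conductorNorm ℤ = N → ∀ D : ModularParametrizationData (freyCurve a b) N,
      (∀ D' : ModularParametrizationData (freyCurve a b) N, D.deg ≤ D'.deg) →
      (D.deg : ℝ) ≤ K * (N : ℝ) ^ (1 + θ) * max (|(a : ℝ)|) (|(b : ℝ)|)

/-- B2 ⟸ B1 ∧ `hM` (PROVED, gen 2). [folklore] -/
theorem minimalDegUpper_of {θ : ℝ} (h1 : DegUpperArch θ) (hM : FreyManinBound) :
    MinimalDegUpper θ := by
  obtain ⟨K, hK⟩ := h1
  obtain ⟨M, hMc⟩ := hM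
  refine ⟨max K 0 * (M : ℝ) ^ 2, fun a b hab h0 N _ hN D hDmin ↦ ?_⟩
  obtain ⟨D₁, hD₁⟩ := hMc a b hab h0 N hN
  have h := hK a b hab h0 N hN D₁
  have hmin : (D.deg : ℝ) ≤ (D₁.modularDegree : ℝ) := by exact_mod_cast hDmin D₁
  have hcM : |(D₁.maninConstant : ℝ)| ≤ (M : ℝ) := by
    have h' : ((D₁.maninConstant.natAbs : ℕ) : ℝ) ≤ (M : ℝ) := by exact_mod_cast hD₁
    simpa [Nat.cast_natAbs, Int.cast_abs] using h'
  have hc2 : (D₁.maninConstant : ℝ) ^ 2 ≤ (M : ℝ) ^ 2 := by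
    rw [← sq_abs]
    exact pow_le_pow_left₀ (abs_nonneg _) hcM 2
  have hX : 0 ≤ (N : ℝ) ^ (1 + θ) * max (|(a : ℝ)|) (|(b : ℝ)|) :=
    mul_nonneg (by positivity) ((abs_nonneg _).trans (le_max_left _ _))
  calc (D.deg : ℝ) ≤ (D₁.modularDegree : ℝ) := hmin
    _ ≤ K * (D₁.maninConstant : ℝ) ^ 2 * (N : ℝ) ^ (1 + θ) * max (|(a : ℝ)|) (|(b : ℝ)|) := h
    _ = K * ((D₁.maninConstant : ℝ) ^ 2 * ((N : ℝ) ^ (1 + θ) * max (|(a : ℝ)|) (|(b : ℝ)|))) := by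
        ring
    _ ≤ max K 0 * ((D₁.maninConstant : ℝ) ^ 2 * ((N : ℝ) ^ (1 + θ) * max (|(a : ℝ)|) (|(b : ℝ)|))) :=
        mul_le_mul_of_nonneg_right (le_max_left K 0) (mul_nonneg (sq_nonneg _) hX)
    _ ≤ max K 0 * ((M : ℝ) ^ 2 * ((N : ℝ) ^ (1 + θ) * max (|(a : ℝ)|) (|(b : ℝ)|))) :=
        mul_le_mul_of_nonneg_left (mul_le_mul_of_nonneg_right hc2 hX) (le_max_right K 0)
    _ = max K 0 * (M : ℝ) ^ 2 * (N : ℝ) ^ (1 + θ) * max (|(a : ℝ)|) (|(b : ℝ)|) := by ring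

/-- **B3 `SixSmoothCredit`** — THE RESIDUAL (abc-strength): the height excess of a Frey triple over
its conductor is paid for by the `6`-smooth part of the minimal modular degree. -/
def SixSmoothCredit : Prop :=
  ∀ ε : ℝ, 0 < ε → ∃ C : ℝ, ∀ a b : ℤ, IsCoprime a b → a * b * (a + b) ≠ 0 → ∀ (N : ℕ) [NeZero N],
    (freyCurve a b).conductorNorm ℤ = N → ∀ D : ModularParametrizationData (freyCurve a b) N,
      (∀ D' : ModularParametrizationData (freyCurve a b) N, D.deg ≤ D'.deg) →
      max (|(a : ℝ)|) (|(b : ℝ)|) ≤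
        C * (N : ℝ) ^ (1 + ε) * ((ordProj[2] D.deg * ordProj[3] D.deg : ℕ) : ℝ)

/-- Assembly of Plan B (PROVED, gen 2): `cps(deg) ≤ deg/six ≤ K N^{1+ε/2} H/six ≤ K C N^{2+ε}`. [folklore] -/
theorem stub_of_planB (hB2 : ∀ θ : ℝ, 0 < θ → MinimalDegUpper θ) (hB3 : SixSmoothCredit) : Stub := by
  intro ε hε
  obtain ⟨K, hK⟩ := hB2 (ε / 2) (by positivity)
  obtain ⟨C₃, hC₃⟩ := hB3 (ε / 2) (by positivity)
  refine ⟨max K 0 * max C₃ 0, fun a b hab h0 N _ hN D hDmin ↦ ?_⟩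
  have hdeg := hK a b hab h0 N hN D hDmin
  have hH := hC₃ a b hab h0 N hN D hDmin
  set six : ℕ := ordProj[2] D.deg * ordProj[3] D.deg with hsix
  have hsix0 : 0 < six := by rw [hsix]; exact mul_pos (Nat.ordProj_pos _ _) (Nat.ordProj_pos _ _)
  have hsixR : (0 : ℝ) < (six : ℝ) := by exact_mod_cast hsix0
  have hNpos : (0 : ℝ) < (N : ℝ) := by exact_mod_cast Nat.pos_of_ne_zero (NeZero.ne N)
  have hpow : (N : ℝ) ^ (1 + ε / 2) * (N : ℝ) ^ (1 + ε / 2) = (N : ℝ) ^ (2 + ε) := by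
    rw [← Real.rpow_add hNpos]
    congr 1
    ring
  have hHnn : (0 : ℝ) ≤ max (|(a : ℝ)|) (|(b : ℝ)|) := (abs_nonneg _).trans (le_max_left _ _)
  have hNθ : (0 : ℝ) ≤ (N : ℝ) ^ (1 + ε / 2) := by positivity
  have h1 : ((D.deg / six : ℕ) : ℝ) ≤ (D.deg : ℝ) / (six : ℝ) := Nat.cast_div_le
  have h2 : (D.deg : ℝ) ≤ max K 0 * (N : ℝ) ^ (1 + ε / 2) * max (|(a : ℝ)|) (|(b : ℝ)|) :=
    hdeg.trans (mul_le_mul_of_nonneg_right (mul_le_mul_of_nonneg_right (le_max_left K 0) hNθ) hHnn)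
  have h3 : max (|(a : ℝ)|) (|(b : ℝ)|) ≤ max C₃ 0 * (N : ℝ) ^ (1 + ε / 2) * (six : ℝ) :=
    hH.trans (mul_le_mul_of_nonneg_right (mul_le_mul_of_nonneg_right (le_max_left C₃ 0) hNθ)
      hsixR.le)
  have h4 : (D.deg : ℝ) ≤ max K 0 * max C₃ 0 * (N : ℝ) ^ (2 + ε) * (six : ℝ) :=
    calc (D.deg : ℝ)
        ≤ max K 0 * (N : ℝ) ^ (1 + ε / 2) * (max C₃ 0 * (N : ℝ) ^ (1 + ε / 2) * six) :=
          h2.trans (mul_le_mul_of_nonneg_left h3 (mul_nonneg (le_max_right K 0) hNθ))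
      _ = max K 0 * max C₃ 0 * ((N : ℝ) ^ (1 + ε / 2) * (N : ℝ) ^ (1 + ε / 2)) * six := by ring
      _ = max K 0 * max C₃ 0 * (N : ℝ) ^ (2 + ε) * (six : ℝ) := by rw [hpow]
  calc ((D.deg / six : ℕ) : ℝ) ≤ (D.deg : ℝ) / (six : ℝ) := h1
    _ ≤ max K 0 * max C₃ 0 * (N : ℝ) ^ (2 + ε) * (six : ℝ) / (six : ℝ) :=
        div_le_div_of_nonneg_right h4 hsixR.le
    _ = max K 0 * max C₃ 0 * (N : ℝ) ^ (2 + ε) := mul_div_cancel_right₀ _ hsixR.ne'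

/-- **B4 calibration (sorry-free)**: `hUp → hM → abc → Stub`. Closes the loop `Stub ⟺ abc` modulo the
route's binders (converse: `Strategist.abc_of_primeToSix_of_routeBinders`). [folklore] -/
theorem stub_of_abcLe (hUp : PeterssonUpper) (hM : FreyManinBound) (habc : AbcLe) : Stub := by
  intro ε hε
  obtain ⟨C, hC⟩ := abcLe_imp_freyDegreeConjecture_of_petersson_of_manin hUp hM habc ε hε
  refine ⟨C, fun a b hab h0 N _ hN D hDmin ↦ ?_⟩
  obtain ⟨D₀, hD₀⟩ := hC a b hab h0 N hN
  have h1 : ((D.deg / (ordProj[2] D.deg * ordProj[3] D.deg) : ℕ) : ℝ) ≤ (D.deg : ℝ) := by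
    exact_mod_cast Nat.div_le_self _ _
  have h2 : (D.deg : ℝ) ≤ (D₀.deg : ℝ) := by exact_mod_cast hDmin D₀
  exact h1.trans (h2.trans hD₀)

/-! ## Plan C — ℓ-adic / Hecke normal form of a minimal counterexample (congruence module) -/

/-- **C1♯ `CpsClassInvariant`** (gen 2, EXACT form of gen-1 `ClassOptimalTransfer`, `K = 1`): the
prime-to-`6` part of the model-minimal degree of `E_(a,b)` EQUALS that of the class-optimal degree
`δ_f` of its newform. Mechanism: every datum degree is `δ_f · [Λ_W : cΛ_f]` (lattice index of a
`ℚ`-isogeny, `degree_eq_natCard_ker_mulQuotientMap_of_baseChange_eq_curve`); the index is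
`s² · deg ψ₀` with `ψ₀` the cyclic generator of `Hom(A_f, E_(a,b)) ≅ ℤ` and `s ∣ 2` (Manin/Néron
integrality `integral_neronScaling_of_isGloballyMinimal_holds` + the `u = 2` Frey rescaling); `deg ψ₀`
is `6`-smooth because a Frey class has no rational `ℓ`-isogeny for `ℓ ≥ 5`
(`hasIrreducibleModPGaloisRep_freyCurve_of_mazurKenku`: full `2`-torsion ⟹ `X₀(4ℓ)`). -/
def CpsClassInvariant : Prop :=
  ∀ a b : ℤ, IsCoprime a b → a * b * (a + b) ≠ 0 → ∀ (N : ℕ) [NeZero N],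
    (freyCurve a b).conductorNorm ℤ = N → ∀ D : ModularParametrizationData (freyCurve a b) N,
      (∀ D' : ModularParametrizationData (freyCurve a b) N, D.deg ≤ D'.deg) →
      ∀ (W₀ : WeierstrassCurve ℚ) [W₀.IsElliptic] (D₀ : ModularParametrizationData W₀ N),
        D₀.f = D.f →
        (∀ (W' : WeierstrassCurve ℚ) [W'.IsElliptic] (D' : ModularParametrizationData W' N),
            D'.f = D₀.f → D₀.modularDegree ≤ D'.modularDegree) →
        D.deg / (ordProj[2] D.deg * ordProj[3] D.deg) =
          D₀.deg / (ordProj[2] D₀.deg * ordProj[3] D₀.deg)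

/-- C1♯ from the Mazur–Kenku classification (one–two prover cycles, M; mirrors the discharge programme of
`PastenShimura2024_minimalDegree_le_163_mul` with "`≤ 163`" replaced by "`6`-smooth"). -/
theorem cpsClassInvariant_of_mazurKenku (hMK : mazurKenku_exists_cyclic_isogeny) :
    CpsClassInvariant := by
  sorry

/-- **C2 `CongruencePrimeToSix`** — THE RESIDUAL in Hecke dress (≡ atom by ARS Thm 2.1, since
`ℓ² ∤ N` for odd `ℓ` on Frey conductors): `cps(r_f) ≤ C N^{2+ε}`; no minimality binder. -/
def CongruencePrimeToSix : Prop :=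
  ∀ ε : ℝ, 0 < ε → ∃ C : ℝ, ∀ a b : ℤ, IsCoprime a b → a * b * (a + b) ≠ 0 → ∀ (N : ℕ) [NeZero N],
    (freyCurve a b).conductorNorm ℤ = N → ∀ D : ModularParametrizationData (freyCurve a b) N,
      ((congruenceNumber D.f / (ordProj[2] (congruenceNumber D.f) * ordProj[3] (congruenceNumber D.f))
        : ℕ) : ℝ) ≤ C * (N : ℝ) ^ (2 + ε)

/-- `cps` is monotone along divisibility (PROVED, gen 2). [folklore] -/
theorem cps_le_of_dvd {m r : ℕ} (h : m ∣ r) (hr : r ≠ 0) :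
    m / (ordProj[2] m * ordProj[3] m) ≤ r / (ordProj[2] r * ordProj[3] r) := by
  obtain ⟨k, rfl⟩ := h
  have hm : m ≠ 0 := left_ne_zero_of_mul hr
  have hk : k ≠ 0 := right_ne_zero_of_mul hr
  have hcps : ∀ n : ℕ, n / (ordProj[2] n * ordProj[3] n) = ordCompl[3] (ordCompl[2] n) := by
    intro n
    have h3 : (ordCompl[2] n).factorization 3 = n.factorization 3 := by
      rw [Nat.factorization_div (Nat.ordProj_dvd n 2)]
      simp [Nat.prime_two.factorization_pow]
    change n / (ordProj[2] n * ordProj[3] n) = n / ordProj[2] n / 3 ^ (ordCompl[2] n).factorization 3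
    rw [h3, Nat.div_div_eq_div_mul]
  rw [hcps, hcps, Nat.ordCompl_mul, Nat.ordCompl_mul]
  refine Nat.le_mul_of_pos_right _ (Nat.pos_of_ne_zero ?_)
  exact (Nat.ordCompl_pos 3 (Nat.ordCompl_pos 2 hk).ne').ne'

/-- `r_f ≠ 0` for the newform of a datum (PROVED in tree currency: Pasten §5.6). [folklore] -/
theorem congruenceNumber_ne_zero {W : WeierstrassCurve ℚ} {N : ℕ} [NeZero N]
    (D : ModularParametrizationData W N) : congruenceNumber D.f ≠ 0 :=
  (Nat.pos_of_dvd_of_pos D.congruenceNumber_dvd_prod_heckeCongruenceModulus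
    D.prod_heckeCongruenceModulus_pos).ne'

/-- Assembly of Plan C (PROVED, gen 2): class-optimal datum by well-ordering, C1♯, `m_f ∣ r_f` (ARS, named
fact `modularDegree_dvd_congruenceNumber`), `cps_le_of_dvd`, C2. [folklore] -/
theorem stub_of_planC (hC1 : CpsClassInvariant) (hARS : modularDegree_dvd_congruenceNumber)
    (hC2 : CongruencePrimeToSix) : Stub := by
  intro ε hε
  obtain ⟨C, hC⟩ := hC2 ε hε
  refine ⟨C, fun a b hab h0 N _ hN D hDmin ↦ ?_⟩
  haveI := isElliptic_freyCurve h0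
  -- the class of `D`: degrees of data with the same newform, over all elliptic models; pick the least
  have hSne : ({d | ∃ (W' : WeierstrassCurve ℚ) (_ : W'.IsElliptic)
      (D' : ModularParametrizationData W' N), D'.f = D.f ∧ D'.modularDegree = d} : Set ℕ).Nonempty :=
    ⟨D.modularDegree, freyCurve a b, inferInstance, D, rfl, rfl⟩
  obtain ⟨W₀, hW₀, D₀, hf₀, hd₀⟩ := Nat.sInf_mem hSne
  have hmin₀ : ∀ (W' : WeierstrassCurve ℚ) [W'.IsElliptic] (D' : ModularParametrizationData W' N),
      D'.f = D₀.f → D₀.modularDegree ≤ D'.modularDegree := by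
    intro W' _ D' hf'
    rw [hd₀]
    exact Nat.sInf_le ⟨W', inferInstance, D', hf'.trans hf₀, rfl⟩
  have h1 : D.deg / (ordProj[2] D.deg * ordProj[3] D.deg) =
      D₀.deg / (ordProj[2] D₀.deg * ordProj[3] D₀.deg) := hC1 a b hab h0 N hN D hDmin W₀ D₀ hf₀ hmin₀
  have h2 : D₀.deg / (ordProj[2] D₀.deg * ordProj[3] D₀.deg) ≤
      congruenceNumber D₀.f /
        (ordProj[2] (congruenceNumber D₀.f) * ordProj[3] (congruenceNumber D₀.f)) :=
    cps_le_of_dvd (hARS W₀ N D₀ hmin₀) (congruenceNumber_ne_zero D₀)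
  have h3 := hC a b hab h0 N hN D
  rw [← hf₀] at h3
  calc ((D.deg / (ordProj[2] D.deg * ordProj[3] D.deg) : ℕ) : ℝ)
      ≤ ((congruenceNumber D₀.f / (ordProj[2] (congruenceNumber D₀.f) *
          ordProj[3] (congruenceNumber D₀.f)) : ℕ) : ℝ) := by
        rw [h1]; exact_mod_cast h2
    _ ≤ C * (N : ℝ) ^ (2 + ε) := h3

/-! ## Plan D — normal form of a minimal counterexample: the thin-six abc violator -/

/-- **`ThinSixViolators ε θ`**: for every `K` there is a Frey triple with a minimal datum whose
HEIGHT beats `K · N^{1+ε-θ} · sixPart(deg_min)` — an abc violation of exponent `1+ε-θ` whose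
`2`- and `3`-adic congruence depth does NOT absorb the excess. -/
def ThinSixViolators (ε θ : ℝ) : Prop :=
  ∀ K : ℝ, ∃ (a b : ℤ) (N : ℕ) (_ : NeZero N) (D : ModularParametrizationData (freyCurve a b) N),
    IsCoprime a b ∧ a * b * (a + b) ≠ 0 ∧ (freyCurve a b).conductorNorm ℤ = N ∧
    (∀ D' : ModularParametrizationData (freyCurve a b) N, D.deg ≤ D'.deg) ∧
    K * (N : ℝ) ^ (1 + ε - θ) * ((ordProj[2] D.deg * ordProj[3] D.deg : ℕ) : ℝ) <
      max (|(a : ℝ)|) (|(b : ℝ)|)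

/-- **D0 (PROVED, gen 2)**: failure of the residual B3 at `ε` IS a thin-six violating family at
`(ε, 0)`; with `stub_of_planB` this is the normal form "¬Stub ⟹ ¬B3 (given B2)". [folklore] -/
theorem thinSix_of_not_sixSmoothCredit (h : ¬ SixSmoothCredit) :
    ∃ ε : ℝ, 0 < ε ∧ ThinSixViolators ε 0 := by
  simp only [SixSmoothCredit, not_forall, not_exists, not_le] at h
  obtain ⟨ε, hε, hK⟩ := h
  refine ⟨ε, hε, fun K ↦ ?_⟩
  obtain ⟨a, b, hab, h0, N, hNz, hN, D, hDmin, hlt⟩ := hK K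
  exact ⟨a, b, N, hNz, D, hab, h0, hN, hDmin, by simpa using hlt⟩

/-- Normal form of `¬Stub` (PROVED, gen 2): modulo B2, a counterexample to the stub is a thin-six
violating family. [folklore] -/
theorem not_sixSmoothCredit_of_not_stub (hB2 : ∀ θ : ℝ, 0 < θ → MinimalDegUpper θ) (h : ¬ Stub) :
    ¬ SixSmoothCredit := fun hB3 ↦ h (stub_of_planB hB2 hB3)

/-! ## Plan E — the small-conductor extreme is absorbed (nothing finite refutes the stub) -/

/-- Eventual form of the stub: the constant may ignore all conductors below any `N₀`. -/
def StubEventually : Prop :=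
  ∀ ε : ℝ, 0 < ε → ∃ C : ℝ, ∃ N₀ : ℕ, ∀ a b : ℤ, IsCoprime a b → a * b * (a + b) ≠ 0 →
    ∀ (N : ℕ) [NeZero N], (freyCurve a b).conductorNorm ℤ = N → N₀ ≤ N →
    ∀ D : ModularParametrizationData (freyCurve a b) N,
      (∀ D' : ModularParametrizationData (freyCurve a b) N, D.deg ≤ D'.deg) →
      ((D.deg / (ordProj[2] D.deg * ordProj[3] D.deg) : ℕ) : ℝ) ≤ C * (N : ℝ) ^ (2 + ε)

/-- Trivial direction (PROVED). [folklore] -/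
theorem stubEventually_of_stub (h : Stub) : StubEventually := by
  intro ε hε
  obtain ⟨C, hC⟩ := h ε hε
  exact ⟨C, 0, fun a b hab h0 N _ hN _ D hD ↦ hC a b hab h0 N hN D hD⟩

/-- **E1** (S/M): finitely many Frey triples below any conductor bound — `rad(ab(a+b)) ∣ 2N`
(`radical_natAbs_dvd_two_mul_conductorNorm_freyCurve`) and Stewart–Yu IN TREE (`stewart_yu_holds`:
`log c ≤ C rad^{1/3} log³ rad`) bound the height by a function of `N₀`. [folklore] -/
theorem freyTriples_finite (N₀ : ℕ) :
    {p : ℤ × ℤ | IsCoprime p.1 p.2 ∧ p.1 * p.2 * (p.1 + p.2) ≠ 0 ∧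
      (freyCurve p.1 p.2).conductorNorm ℤ ≤ N₀}.Finite := by
  sorry

/-- **E2** (M): the eventual form suffices — below `N₀` there are finitely many triples (E1), each with ONE
minimal degree `sInf {D.deg}`, and `N ≥ 1`; take `C' = max C (∑ over them)`. Consequence: no finite
computation (census) can refute the stub; only an infinite thin-six FAMILY can (Plan D). [folklore] -/
theorem stub_of_stubEventually
    (hfin : ∀ N₀ : ℕ, {p : ℤ × ℤ | IsCoprime p.1 p.2 ∧ p.1 * p.2 * (p.1 + p.2) ≠ 0 ∧
      (freyCurve p.1 p.2).conductorNorm ℤ ≤ N₀}.Finite)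
    (h : StubEventually) : Stub := by
  sorry


/-! ## Gen 3 — the converse direction: `Stub ⟹` six-smooth credit (two-sided extremal normal form) -/

/-- The `6`-smooth part divides. [folklore] -/
theorem six_dvd (n : ℕ) : ordProj[2] n * ordProj[3] n ∣ n :=
  Nat.Coprime.mul_dvd_of_dvd_of_dvd (Nat.Coprime.pow _ _ (by norm_num)) (Nat.ordProj_dvd n 2)
    (Nat.ordProj_dvd n 3)

/-- `deg = cps(deg) · six(deg)` in `ℝ`. [folklore] -/
theorem cast_eq_cps_mul_six (n : ℕ) :
    (n : ℝ) = ((n / (ordProj[2] n * ordProj[3] n) : ℕ) : ℝ) * ((ordProj[2] n * ordProj[3] n : ℕ) : ℝ) := by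
  rw [← Nat.cast_mul, Nat.div_mul_cancel (six_dvd n)]

/-- **L1 `DegLowerArch θ`** (abc-free, EVERY datum, no minimality needed):
`k_θ · N^{1-θ} · H^{1-θ} ≤ deg D`, `H = max(|a|,|b|)`. -/
def DegLowerArch (θ : ℝ) : Prop :=
  ∃ k : ℝ, 0 < k ∧ ∀ a b : ℤ, IsCoprime a b → a * b * (a + b) ≠ 0 → ∀ (N : ℕ) [NeZero N],
    (freyCurve a b).conductorNorm ℤ = N → ∀ D : ModularParametrizationData (freyCurve a b) N,
      k * (N : ℝ) ^ (1 - θ) * (max (|(a : ℝ)|) (|(b : ℝ)|)) ^ (1 - θ) ≤ (D.deg : ℝ)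

/-- L1 from the route binder `PeterssonLowerBound` (M; this is the first half of the tree proof of
`abcLe_rpow_of_freyDegreeConjecture_of_petersson`, run without a degree hypothesis): Zagier
`four_pi_sq_mul_peterssonProduct_re_le_deg_mul_covolume` (`4π² Re(f,f) ≤ deg · covol Λ_W`, `c² ≥ 1`
absorbed), `hP` at `ε = θ`, the Frey rescaling `u ∈ {1,2}` (`smul_freyCurve_eq_baseChange_freyIntModel₂`,
`covol Λ_W = u⁻² covol Λ_min ≤ covol Λ_min`), Silverman PROVED
`silverman1986_discriminant_c4_covolume_holds` at `δ = 6θ` on the minimal model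
(`|c₄,min|³ ≤ A covol^{-(6+δ)}`), and `c₄(E_(a,b)) = 16(a²+ab+b²) ≥ 12 H²`, so `|c₄,min| ≥ (3/4)H²` and
`covol⁻¹ ≥ A' H^{6/(6+δ)} ≥ A' H^{1-θ}` (`H ≥ 1`). [folklore] -/
theorem degLowerArch_of_peterssonLower (hP : Summit.ABC.ABC.Theses.DefiniteXi.PeterssonLowerBound) :
    ∀ θ : ℝ, 0 < θ → DegLowerArch θ := by
  sorry

/-- **L2 `SixSmoothCreditPow`** — the converse residual: for every `ε, θ > 0`,
`H^{1-θ} ≤ C · N^{1+ε} · six(deg_min)`. (Gen-2 `SixSmoothCredit` is the case `θ = 0`.) -/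
def SixSmoothCreditPow : Prop :=
  ∀ ε : ℝ, 0 < ε → ∀ θ : ℝ, 0 < θ → ∃ C : ℝ, ∀ a b : ℤ, IsCoprime a b → a * b * (a + b) ≠ 0 →
    ∀ (N : ℕ) [NeZero N], (freyCurve a b).conductorNorm ℤ = N →
    ∀ D : ModularParametrizationData (freyCurve a b) N,
      (∀ D' : ModularParametrizationData (freyCurve a b) N, D.deg ≤ D'.deg) →
      (max (|(a : ℝ)|) (|(b : ℝ)|)) ^ (1 - θ) ≤
        C * (N : ℝ) ^ (1 + ε) * ((ordProj[2] D.deg * ordProj[3] D.deg : ℕ) : ℝ)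

/-- **The converse (PROVED, gen 3)**: `L1 → Stub → SixSmoothCreditPow`. With `stub_of_planB` this is the
two-sided extremal normal form `SixSmoothCredit ⟹ Stub ⟹ SixSmoothCreditPow` (modulo the dischargeable
binders B1/B2 and L1): a counterexample to the stub is EXACTLY a Frey family whose height excess over
`N^{1+ε}` is not paid by the `2·3`-part of the minimal degree. [folklore] -/
theorem sixSmoothCreditPow_of_stub (hL : ∀ θ : ℝ, 0 < θ → DegLowerArch θ) (h : Stub) :
    SixSmoothCreditPow := by
  intro ε hε θ hθ
  set θ₁ : ℝ := min θ (ε / 2) with hθ₁def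
  have hθ₁ : 0 < θ₁ := lt_min hθ (by positivity)
  have hθ₁θ : θ₁ ≤ θ := min_le_left _ _
  have hθ₁ε : θ₁ ≤ ε / 2 := min_le_right _ _
  obtain ⟨k, hk, hkL⟩ := hL θ₁ hθ₁
  obtain ⟨C, hC⟩ := h (ε / 2) (by positivity)
  refine ⟨max C 0 / k, fun a b hab h0 N _ hN D hDmin ↦ ?_⟩
  set six : ℕ := ordProj[2] D.deg * ordProj[3] D.deg with hsix
  set H : ℝ := max (|(a : ℝ)|) (|(b : ℝ)|) with hH
  have hsix0 : 0 < six := by rw [hsix]; exact mul_pos (Nat.ordProj_pos _ _) (Nat.ordProj_pos _ _)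
  have hsixR : (0 : ℝ) < (six : ℝ) := by exact_mod_cast hsix0
  have hNpos : (0 : ℝ) < (N : ℝ) := by exact_mod_cast Nat.pos_of_ne_zero (NeZero.ne N)
  have hN1 : (1 : ℝ) ≤ (N : ℝ) := by exact_mod_cast Nat.one_le_iff_ne_zero.mpr (NeZero.ne N)
  have ha0 : a ≠ 0 := by rintro rfl; simp at h0
  have hH1 : (1 : ℝ) ≤ H := by
    have h1 : (1 : ℝ) ≤ |(a : ℝ)| := by exact_mod_cast Int.one_le_abs ha0
    exact h1.trans (le_max_left _ _)
  -- the two bounds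
  have hlow : k * (N : ℝ) ^ (1 - θ₁) * H ^ (1 - θ₁) ≤ (D.deg : ℝ) := hkL a b hab h0 N hN D
  have hcps : ((D.deg / six : ℕ) : ℝ) ≤ max C 0 * (N : ℝ) ^ (2 + ε / 2) :=
    (hC a b hab h0 N hN D hDmin).trans
      (mul_le_mul_of_nonneg_right (le_max_left C 0) (by positivity))
  have hdeg : (D.deg : ℝ) ≤ max C 0 * (N : ℝ) ^ (2 + ε / 2) * (six : ℝ) := by
    rw [cast_eq_cps_mul_six D.deg]
    exact mul_le_mul_of_nonneg_right hcps hsixR.le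
  -- split `N^{2+ε/2} = N^{1-θ₁} · N^{1+ε/2+θ₁}` and cancel
  have hsplit : (N : ℝ) ^ (2 + ε / 2) = (N : ℝ) ^ (1 - θ₁) * (N : ℝ) ^ (1 + ε / 2 + θ₁) := by
    rw [← Real.rpow_add hNpos]; congr 1; ring
  have hNθ : (0 : ℝ) < (N : ℝ) ^ (1 - θ₁) := Real.rpow_pos_of_pos hNpos _
  have h1 : (N : ℝ) ^ (1 - θ₁) * (k * H ^ (1 - θ₁)) ≤
      (N : ℝ) ^ (1 - θ₁) * (max C 0 * (N : ℝ) ^ (1 + ε / 2 + θ₁) * (six : ℝ)) := by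
    have := hlow.trans hdeg
    rw [hsplit] at this
    calc (N : ℝ) ^ (1 - θ₁) * (k * H ^ (1 - θ₁)) = k * (N : ℝ) ^ (1 - θ₁) * H ^ (1 - θ₁) := by ring
      _ ≤ max C 0 * ((N : ℝ) ^ (1 - θ₁) * (N : ℝ) ^ (1 + ε / 2 + θ₁)) * (six : ℝ) := this
      _ = (N : ℝ) ^ (1 - θ₁) * (max C 0 * (N : ℝ) ^ (1 + ε / 2 + θ₁) * (six : ℝ)) := by ring
  have h2 : k * H ^ (1 - θ₁) ≤ max C 0 * (N : ℝ) ^ (1 + ε / 2 + θ₁) * (six : ℝ) :=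
    le_of_mul_le_mul_left h1 hNθ
  have h3 : H ^ (1 - θ₁) ≤ max C 0 / k * (N : ℝ) ^ (1 + ε / 2 + θ₁) * (six : ℝ) := by
    have : H ^ (1 - θ₁) ≤ (max C 0 * (N : ℝ) ^ (1 + ε / 2 + θ₁) * (six : ℝ)) / k := by
      rw [le_div_iff₀ hk]; linarith [h2]
    calc H ^ (1 - θ₁) ≤ (max C 0 * (N : ℝ) ^ (1 + ε / 2 + θ₁) * (six : ℝ)) / k := this
      _ = max C 0 / k * (N : ℝ) ^ (1 + ε / 2 + θ₁) * (six : ℝ) := by ring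
  -- monotonicity in the exponents (`H ≥ 1`, `N ≥ 1`)
  have h4 : H ^ (1 - θ) ≤ H ^ (1 - θ₁) := Real.rpow_le_rpow_of_exponent_le hH1 (by linarith)
  have h5 : (N : ℝ) ^ (1 + ε / 2 + θ₁) ≤ (N : ℝ) ^ (1 + ε) :=
    Real.rpow_le_rpow_of_exponent_le hN1 (by linarith)
  have hCk : (0 : ℝ) ≤ max C 0 / k := div_nonneg (le_max_right C 0) hk.le
  calc H ^ (1 - θ) ≤ H ^ (1 - θ₁) := h4
    _ ≤ max C 0 / k * (N : ℝ) ^ (1 + ε / 2 + θ₁) * (six : ℝ) := h3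
    _ ≤ max C 0 / k * (N : ℝ) ^ (1 + ε) * (six : ℝ) :=
        mul_le_mul_of_nonneg_right (mul_le_mul_of_nonneg_left h5 hCk) hsixR.le

/-- Gen-2's `θ = 0` residual implies the `θ > 0` family (PROVED; `H ≥ 1`). [folklore] -/
theorem sixSmoothCreditPow_of_sixSmoothCredit (h : SixSmoothCredit) : SixSmoothCreditPow := by
  intro ε hε θ hθ
  obtain ⟨C, hC⟩ := h ε hε
  refine ⟨C, fun a b hab h0 N _ hN D hDmin ↦ ?_⟩
  have ha0 : a ≠ 0 := by rintro rfl; simp at h0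
  have hH1 : (1 : ℝ) ≤ max (|(a : ℝ)|) (|(b : ℝ)|) := by
    have h1 : (1 : ℝ) ≤ |(a : ℝ)| := by exact_mod_cast Int.one_le_abs ha0
    exact h1.trans (le_max_left _ _)
  calc (max (|(a : ℝ)|) (|(b : ℝ)|)) ^ (1 - θ) ≤ (max (|(a : ℝ)|) (|(b : ℝ)|)) ^ (1 : ℝ) :=
        Real.rpow_le_rpow_of_exponent_le hH1 (by linarith)
    _ = max (|(a : ℝ)|) (|(b : ℝ)|) := Real.rpow_one _
    _ ≤ C * (N : ℝ) ^ (1 + ε) * ((ordProj[2] D.deg * ordProj[3] D.deg : ℕ) : ℝ) :=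
        hC a b hab h0 N hN D hDmin

/-! ## Gen 3 — the census instrument: the LOCAL SIX LAW (conjecture under test, kit j344564) -/

/-- **`SixLocal`** (instrument, NOT a stub): the `6`-smooth part of the minimal degree of `E_(a,b)` is
LOCAL up to `A^{ω(N)}` — controlled by the `6`-smooth part of `T = ∏_{q ∣ N} v_q(Δ_min)` (component
groups / level-lowering depth), with an Atkin–Lehner–Eisenstein allowance `A` per bad prime. -/
def SixLocal : Prop :=
  ∃ A K : ℝ, ∀ a b : ℤ, IsCoprime a b → a * b * (a + b) ≠ 0 → ∀ (N : ℕ) [NeZero N],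
    (freyCurve a b).conductorNorm ℤ = N → ∀ D : ModularParametrizationData (freyCurve a b) N,
      (∀ D' : ModularParametrizationData (freyCurve a b) N, D.deg ≤ D'.deg) →
      ((ordProj[2] D.deg * ordProj[3] D.deg : ℕ) : ℝ) ≤
        K * A ^ N.primeFactors.card *
          ((∏ q ∈ N.primeFactors, ((freyCurve a b).minimalDiscriminantNorm ℤ).factorization q : ℕ) : ℝ)

/-- abc for Frey triples, height form (`H ≤ C N^{1+ε}`; the tree converts it to `ABC` via
`radical_natAbs_dvd_two_mul_conductorNorm_freyCurve`-type bookkeeping, cf. `Strategist.abc_of_…`). -/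
def FreyHeightBound : Prop :=
  ∀ ε : ℝ, 0 < ε → ∃ C : ℝ, ∀ a b : ℤ, IsCoprime a b → a * b * (a + b) ≠ 0 → ∀ (N : ℕ) [NeZero N],
    (freyCurve a b).conductorNorm ℤ = N → max (|(a : ℝ)|) (|(b : ℝ)|) ≤ C * (N : ℝ) ^ (1 + ε)

/-- **Payoff of the instrument (M, real analysis)**: `L1 ∧ Stub ∧ SixLocal ⟹ abc` for Frey triples —
Brandt-free and WITHOUT child 3 (`AbcValuationProduct`). Proof on paper: `k N^{1-θ} H^{1-θ} ≤ deg_min =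
cps · six ≤ C N^{2+ε} · K A^{ω(N)} · ∏_q v_q(Δ_min)`; AM–GM `∏_{q∣N} v_q(Δ_min) ≤ (log|Δ_min| /(ω log 2))^{ω}`
with `log|Δ_min| ≤ 6 log H + 8 log 2`, and `ω(N) ≤ (1+o(1)) log N / log log N` (hypothesis `hω`, Hardy–Wright
§22.10) make the right side `N^{1+ε+θ+o(1)} H^{o(1)}`; bootstrap in `x = log H / log N`. The existence
of modular data for every Frey curve (`hmod`, = route binder `FreyModularity` in D-form) is needed to
instantiate the minimal datum. [folklore] -/
theorem freyHeightBound_of_stub_of_sixLocal (hL : ∀ θ : ℝ, 0 < θ → DegLowerArch θ) (h : Stub)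
    (h6 : SixLocal)
    (hω : ∀ η : ℝ, 0 < η → ∃ N₀ : ℕ, ∀ N : ℕ, N₀ ≤ N → (N.primeFactors.card : ℝ) ≤ η * Real.log N)
    (hmod : ∀ a b : ℤ, IsCoprime a b → a * b * (a + b) ≠ 0 → ∀ (N : ℕ) [NeZero N],
      (freyCurve a b).conductorNorm ℤ = N → Nonempty (ModularParametrizationData (freyCurve a b) N)) :
    FreyHeightBound := by
  sorry

end Summit.ABC.ABC.Cruxes.SteinbergCore.StubIdeas3

end
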